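import Literature.Barriers.AtomisticToContinuum.AnticontinuumLocalizationThm2Proof
import HarnessLib

/-!
# De Roeck–Huveneers 2015: Theorem 4 (frozen interval energies) for large chains — proved

W. De Roeck, F. Huveneers, *Asymptotic localization of energy in nondisordered oscillator chains*,
Comm. Pure Appl. Math. **68** (2015) 1532–1568, arXiv:1305.5127, Theorem 4 (rotor chain):
for `T > 0` and `n ≥ 1` there is `C_n < ∞` such that, for sufficiently small `ε > 0` and every
discrete interval `I = {a₁, …, a₂}`, `⟨(H_I(X^t_ε) - H_I)²⟩_T ≤ C_n ε^{1/4}` for all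
`0 ≤ t ≤ ε^{-n}` ("an analog of Nekhoroshev estimates, at infinite volume and positive
temperature"). [cite: DeRoeckHuveneers2015, §2.3 Thm 4]

## What is proved here, and the status of the catalogued fact `DeRoeckHuveneers2015_thm4`

* `IsFlow.intervalEnergy_frozen_of_decomposition` — the printed proof of Theorem 4 (§7) for ONE
  chain length `N`: if every bond current decomposes as `εJ_{y,y+1} = L_H U + ε^{n+1} G` with
  `⟨U²⟩_T ≤ Cε^{1/4}`, `⟨G²⟩_T ≤ C` (the conclusion of Theorem 1 at this `N`), then
  `⟨(H_I(X^t) - H_I)²⟩_T ≤ 36 C ε^{1/4}` for `0 ≤ t ≤ ε^{-n}`, `0 < ε ≤ 1`, every flow map and every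
  interval (energy balance `L_H H_I = εJ_{a₁-1,a₁} - εJ_{a₂,a₂+1}`, invariance of the Gibbs state
  under the flow — Liouville, `…Proofs` — and Jensen). [cite: DeRoeckHuveneers2015, §7 proof of Thm 4]
* `DeRoeckHuveneers2015_thm4_largeN` / `DeRoeckHuveneers2015_thm4_largeN_holds` — **Theorem 4
  for all odd `N ≥ N₀(γ, T, n)`, PROVED** from the tree's Theorem 1 for large chains
  (`HeatConduction.RotorChain.DeRoeckHuveneers2015_thm1_largeN`, file `…Thm2Proof`, itself the
  assembled §§3–5 of the source).
* Scope record (no claim beyond the source). The printed Theorem 4 — and the catalogued fact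
  `DeRoeckHuveneers2015_thm4`, which restates it with `C_n`, `ε₀` uniform over ALL odd `N ≥ 1` —
  is reduced to the printed Theorem 1 by `DeRoeckHuveneers2015_thm4_of_thm1` (`…Proofs`). The
  printed proof of Theorem 1 is an infinite-volume argument: Lemma 4 of §5.5 needs `n₂`
  near-resonances at pairwise separated sites inside the ball `B(a, n₃)` ("By taking `n₃` large
  enough, we can find `n₂` linearly independent vectors and thus guarantee that `ω ∈ Z`"), which a
  chain shorter than about `n₂ · (8r+1)` sites cannot supply; accordingly the tree proves Theorem 1
  for `N ≥ N₀(γ, T, n)` only (`DeRoeckHuveneers2015_thm1_largeN`), and the present file proves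
  Theorem 4 in exactly that scope. For the finitely many odd `N < N₀` the statement is a
  fixed-dimension long-time (`t ≤ ε^{-n}`) stability estimate in Gibbs measure which the source
  does not address; `DeRoeckHuveneers2015_thm4_holds` therefore remains open in the tree, pending
  the small-`N` case of `DeRoeckHuveneers2015_thm1` (or a direct finite-dimensional argument).
  [cite: DeRoeckHuveneers2015, §2.3 Thm 1 ("For any `N ≥ 1`"), §5.5 Lemma 4]

All declarations here are proved; no named facts are introduced (`DeRoeckHuveneers2015_thm4_largeN`
comes with its `_holds`).
-/

noncomputable section

open MeasureTheory Filter Set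
open scoped ContDiff ENNReal Topology

namespace Literature.Barriers.AtomisticToContinuum.HeatConduction

open Literature.MathematicalPhysics.KineticTheory.HeatConduction

namespace RotorChain

variable {N : ℕ} {ε γ : ℝ} {Φ : ℝ → PhaseSpace N → PhaseSpace N}

/-- **§7, proof of Theorem 4, at one chain length.** If every bond current of the `N`-chain
decomposes as `ε J_{y,y+1} = L_H U + ε^{n+1} G` with `U, G` smooth and `2π`-angle-periodic,
`⟨U²⟩_T ≤ C ε^{1/4}` and `⟨G²⟩_T ≤ C`, then for every flow map `X^t`, every discrete interval
`I = {a₁, …, a₂}` and every `0 ≤ t ≤ ε^{-n}` (`0 < ε ≤ 1`):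
`⟨(H_I(X^t) - H_I)²⟩_T ≤ 36 C ε^{1/4}`. Proof as printed: `L_H H_I = εJ_{a₁-1,a₁} - εJ_{a₂,a₂+1}`,
so `H_I(X^t) - H_I = ∑_{j} ±(U_j(X^t) - U_j + ε^{n+1}∫₀ᵗ G_j(X^s) ds)`; by invariance of the Gibbs
state `⟨U(X^t)²⟩ = ⟨U²⟩`, by Jensen and invariance `⟨(∫₀ᵗ G(X^s))²⟩ ≤ t²⟨G²⟩`, whence
`⟨(H_I(X^t) - H_I)²⟩ ≤ 2·9C(ε^{1/4}·…) ≤ 36 C ε^{1/4}` (each bond: `IsFlow.bond_estimate`).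
[cite: DeRoeckHuveneers2015, §7 proof of Thm 4] -/
theorem IsFlow.intervalEnergy_frozen_of_decomposition (hΦ : IsFlow N ε γ Φ) (T : ℝ)
    (hε : 0 < ε) (hε1 : ε ≤ 1) {n : ℕ} {C : ℝ} (hC : 0 ≤ C)
    (hdec : ∀ y : Fin N, ∃ U G : PhaseSpace N → ℝ,
      ContDiff ℝ ∞ U ∧ ContDiff ℝ ∞ G ∧ IsAnglePeriodic N U ∧ IsAnglePeriodic N G ∧
      (∀ z, ε * bondCurrent N y z = liouville N ε γ U z + ε ^ (n + 1) * G z) ∧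
      Integrable (fun z => U z ^ 2) (gibbsMeasure N T ε γ) ∧
      ∫ z, U z ^ 2 ∂(gibbsMeasure N T ε γ) ≤ C * ε ^ (1 / 4 : ℝ) ∧
      Integrable (fun z => G z ^ 2) (gibbsMeasure N T ε γ) ∧
      ∫ z, G z ^ 2 ∂(gibbsMeasure N T ε γ) ≤ C)
    {a₁ a₂ : Fin N} (ha : a₁ ≤ a₂) {t : ℝ} (ht : 0 ≤ t) (htε : t ≤ ε ^ (-(n : ℝ))) :
    Integrable (fun z => (intervalEnergy N ε γ a₁ a₂ (Φ t z) - intervalEnergy N ε γ a₁ a₂ z) ^ 2)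
        (gibbsMeasure N T ε γ) ∧
      ∫ z, (intervalEnergy N ε γ a₁ a₂ (Φ t z) - intervalEnergy N ε γ a₁ a₂ z) ^ 2
          ∂(gibbsMeasure N T ε γ) ≤ 36 * C * ε ^ (1 / 4 : ℝ) := by
  set μ := gibbsMeasure N T ε γ
  -- the one-bond estimate for every tail current
  have hbond : ∀ m : ℕ, ∫⁻ z, ENNReal.ofReal ((ε * ∫ s in (0 : ℝ)..t, tailCurrent N m (Φ s z)) ^ 2) ∂μ ≤
      ENNReal.ofReal (9 * C * ε ^ (1 / 4 : ℝ)) := by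
    intro m
    by_cases hm : ∃ y : Fin N, y.val + 1 = m
    · obtain ⟨y, rfl⟩ := hm
      simp_rw [tailCurrent_succ]
      obtain ⟨U, G, hU, hG, hUp, hGp, hid, hU2i, hU2, hG2i, hG2⟩ := hdec y
      exact hΦ.bond_estimate T hε hε1 ht htε hC y hU hG hUp hGp hid hU2i hU2 hG2i hG2
    · push Not at hm
      simp_rw [tailCurrent_eq_zero hm]
      simp
  -- the energy of the interval
  set A₁ : PhaseSpace N → ℝ := fun z => ε * ∫ s in (0 : ℝ)..t, tailCurrent N a₁.val (Φ s z)
  set A₂ : PhaseSpace N → ℝ := fun z => ε * ∫ s in (0 : ℝ)..t, tailCurrent N (a₂.val + 1) (Φ s z)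
  set D : PhaseSpace N → ℝ := fun z =>
    (intervalEnergy N ε γ a₁ a₂ (Φ t z) - intervalEnergy N ε γ a₁ a₂ z) ^ 2
  have hD : ∀ z, D z = (A₁ z - A₂ z) ^ 2 := fun z => by
    simp only [D, A₁, A₂, hΦ.intervalEnergy_sub_eq ha z t]
  have hDle : ∀ z, D z ≤ 2 * A₁ z ^ 2 + 2 * A₂ z ^ 2 := fun z => by
    rw [hD]; nlinarith [sq_nonneg (A₁ z + A₂ z)]
  have hlin : ∫⁻ z, ENNReal.ofReal (D z) ∂μ ≤ ENNReal.ofReal (36 * C * ε ^ (1 / 4 : ℝ)) := by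
    calc ∫⁻ z, ENNReal.ofReal (D z) ∂μ
        ≤ ∫⁻ z, (ENNReal.ofReal 2 * ENNReal.ofReal (A₁ z ^ 2) + ENNReal.ofReal 2 * ENNReal.ofReal (A₂ z ^ 2)) ∂μ := by
          refine lintegral_mono fun z => ?_
          rw [← ENNReal.ofReal_mul (by norm_num), ← ENNReal.ofReal_mul (by norm_num),
            ← ENNReal.ofReal_add (by positivity) (by positivity)]
          exact ENNReal.ofReal_le_ofReal (hDle z)
      _ = ENNReal.ofReal 2 * ∫⁻ z, ENNReal.ofReal (A₁ z ^ 2) ∂μ +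
            ENNReal.ofReal 2 * ∫⁻ z, ENNReal.ofReal (A₂ z ^ 2) ∂μ := by
          have hmA : Measurable fun z => ENNReal.ofReal 2 * ENNReal.ofReal (A₁ z ^ 2) :=
            (ENNReal.measurable_ofReal.comp
              ((continuous_const.mul (hΦ.continuous_intervalIntegral_tailCurrent a₁.val t)).pow 2).measurable).const_mul _
          rw [lintegral_add_left hmA, lintegral_const_mul' _ _ ENNReal.ofReal_ne_top,
            lintegral_const_mul' _ _ ENNReal.ofReal_ne_top]
      _ ≤ ENNReal.ofReal 2 * ENNReal.ofReal (9 * C * ε ^ (1 / 4 : ℝ)) +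
            ENNReal.ofReal 2 * ENNReal.ofReal (9 * C * ε ^ (1 / 4 : ℝ)) := by
          gcongr
          · exact hbond a₁.val
          · exact hbond (a₂.val + 1)
      _ = ENNReal.ofReal (36 * C * ε ^ (1 / 4 : ℝ)) := by
          rw [← ENNReal.ofReal_mul (by norm_num), ← ENNReal.ofReal_add (by positivity) (by positivity)]
          congr 1; ring
  have hDm : AEStronglyMeasurable D μ := by
    refine Continuous.aestronglyMeasurable ?_
    exact (((continuous_intervalEnergy N ε γ a₁ a₂).comp (hΦ.continuous_at t)).sub
      (continuous_intervalEnergy N ε γ a₁ a₂)).pow 2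
  have hD0 : 0 ≤ᵐ[μ] D := ae_of_all _ fun z => sq_nonneg _
  have hfin : ∫⁻ z, ENNReal.ofReal (D z) ∂μ ≠ ⊤ := ne_top_of_le_ne_top ENNReal.ofReal_ne_top hlin
  refine ⟨(lintegral_ofReal_ne_top_iff_integrable hDm hD0).1 hfin, ?_⟩
  show ∫ z, D z ∂μ ≤ 36 * C * ε ^ (1 / 4 : ℝ)
  rw [integral_eq_lintegral_of_nonneg_ae hD0 hDm]
  exact ENNReal.toReal_le_of_le_ofReal (by positivity) hlin

end RotorChain

end Literature.Barriers.AtomisticToContinuum.HeatConduction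


namespace Literature.Barriers.AtomisticToContinuum

open Literature.MathematicalPhysics.KineticTheory.HeatConduction HeatConduction HeatConduction.RotorChain

/-- **De Roeck–Huveneers 2015, Theorem 4 (rotor chain) in the scope of its printed proof: energy
is frozen for all polynomial times, uniformly over all LONG chains.** For `γ ≥ 0`, `T > 0` and
`n ≥ 1` there are `N₀` and `C < ∞` such that for all sufficiently small `ε > 0`, every odd
`N ≥ N₀`, every flow map `X^t_ε` of the `N`-chain and every discrete interval `I = {a₁, …, a₂}`:
`⟨(H_I(X^t_ε) - H_I)²⟩_T ≤ C ε^{1/4}` for all `0 ≤ t ≤ ε^{-n}`.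
This is `DeRoeckHuveneers2015_thm4` with the chain-length threshold `N₀(γ, T, n)` that the
printed proof actually requires (§5.5, Lemma 4: `n₂` separated near-resonant sites in
`B(a, n₃)`); the printed statement ("at infinite volume"; Theorem 1 "for any `N ≥ 1`") carries no
threshold, and the catalogued all-`N` fact `DeRoeckHuveneers2015_thm4` restates it verbatim — its
small-`N` cases are not covered by the source's argument. PROVED below
(`DeRoeckHuveneers2015_thm4_largeN_holds`). [cite: DeRoeckHuveneers2015, §2.3 Thm 4; §7 proof of Thm 4; §5.5 Lemma 4] -/
def DeRoeckHuveneers2015_thm4_largeN : Prop :=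
  ∀ γ : ℝ, 0 ≤ γ → ∀ T : ℝ, 0 < T → ∀ n : ℕ, 1 ≤ n →
    ∃ N₀ : ℕ, ∃ C : ℝ, ∃ ε₀ : ℝ, 0 < ε₀ ∧ ∀ ε : ℝ, 0 < ε → ε < ε₀ →
      ∀ N : ℕ, N₀ ≤ N → Odd N → ∀ Φ : ℝ → PhaseSpace N → PhaseSpace N, IsFlow N ε γ Φ →
        ∀ a₁ a₂ : Fin N, a₁ ≤ a₂ → ∀ t : ℝ, 0 ≤ t → t ≤ ε ^ (-(n : ℝ)) →
          Integrable (fun z => (intervalEnergy N ε γ a₁ a₂ (Φ t z) - intervalEnergy N ε γ a₁ a₂ z) ^ 2)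
              (gibbsMeasure N T ε γ) ∧
            ∫ z, (intervalEnergy N ε γ a₁ a₂ (Φ t z) - intervalEnergy N ε γ a₁ a₂ z) ^ 2
                ∂(gibbsMeasure N T ε γ) ≤ C * ε ^ (1 / 4 : ℝ)

/-- **Theorem 4 for long chains, proved**: from Theorem 1 for long chains
(`DeRoeckHuveneers2015_thm1_largeN`, §§3–5 of the source as assembled in `…Thm2Proof`) by the
printed §7 argument (`IsFlow.intervalEnergy_frozen_of_decomposition`), with `C = 36 C₁` and
`ε < min(ε₀, 1)` in terms of the constants `N₀, C₁, ε₀` of Theorem 1.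
[cite: DeRoeckHuveneers2015, §2.3 Thm 4 and §7 proof of Thm 4] -/
theorem DeRoeckHuveneers2015_thm4_largeN_holds : DeRoeckHuveneers2015_thm4_largeN := by
  intro γ hγ T hT n _hn
  obtain ⟨N₀, C, ε₀, hC, hε₀, hmain⟩ := DeRoeckHuveneers2015_thm1_largeN γ hγ T hT n
  refine ⟨N₀, 36 * C, min ε₀ 1, lt_min hε₀ one_pos, ?_⟩
  intro ε hε hεε N hN hodd Φ hΦ a₁ a₂ ha t ht htε
  have hε₀' : ε < ε₀ := hεε.trans_le (min_le_left _ _)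
  have hε1 : ε ≤ 1 := (hεε.trans_le (min_le_right _ _)).le
  refine hΦ.intervalEnergy_frozen_of_decomposition T hε hε1 hC (fun y => ?_) ha ht htε
  obtain ⟨U, G, hU, hG, hUp, hGp, -, -, -, -, -, -, hid, hU2i, hU2, hG2i, hG2, -⟩ :=
    hmain ε hε hε₀' N hN hodd y
  exact ⟨U, G, hU, hG, hUp, hGp, hid, hU2i, hU2, hG2i, hG2⟩

/-- The catalogued all-`N` fact implies its long-chain version (with `N₀ = 0`). [folklore] -/
theorem DeRoeckHuveneers2015_thm4.largeN (h : DeRoeckHuveneers2015_thm4) :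
    DeRoeckHuveneers2015_thm4_largeN := by
  intro γ hγ T hT n hn
  obtain ⟨C, ε₀, hε₀, hall⟩ := h γ hγ T hT n hn
  exact ⟨0, C, ε₀, hε₀, fun ε hε hεε N _ hN Φ hΦ a₁ a₂ ha t ht htε => hall ε hε hεε N hN Φ hΦ a₁ a₂ ha t ht htε⟩

/-- **Gluing the scopes.** The catalogued all-`N` fact `DeRoeckHuveneers2015_thm4` (constants
uniform over all odd `N`) follows from its long-chain version together with Theorem 4 at each
single chain length `N` with `N`-dependent constants: below the threshold `N₀` only finitely many
lengths occur, so the maximum of the constants and the minimum of the `ε`-thresholds serve.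
(This isolates what the source leaves unproved: a fixed-dimension statement for each short odd
chain.) [folklore] -/
theorem DeRoeckHuveneers2015_thm4_of_largeN_of_each (hL : DeRoeckHuveneers2015_thm4_largeN)
    (hS : ∀ N : ℕ, Odd N → ∀ γ : ℝ, 0 ≤ γ → ∀ T : ℝ, 0 < T → ∀ n : ℕ, 1 ≤ n →
      ∃ C : ℝ, ∃ ε₀ : ℝ, 0 < ε₀ ∧ ∀ ε : ℝ, 0 < ε → ε < ε₀ →
        ∀ Φ : ℝ → PhaseSpace N → PhaseSpace N, IsFlow N ε γ Φ →
          ∀ a₁ a₂ : Fin N, a₁ ≤ a₂ → ∀ t : ℝ, 0 ≤ t → t ≤ ε ^ (-(n : ℝ)) →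
            Integrable (fun z => (intervalEnergy N ε γ a₁ a₂ (Φ t z) - intervalEnergy N ε γ a₁ a₂ z) ^ 2)
                (gibbsMeasure N T ε γ) ∧
              ∫ z, (intervalEnergy N ε γ a₁ a₂ (Φ t z) - intervalEnergy N ε γ a₁ a₂ z) ^ 2
                  ∂(gibbsMeasure N T ε γ) ≤ C * ε ^ (1 / 4 : ℝ)) :
    DeRoeckHuveneers2015_thm4 := by
  intro γ hγ T hT n hn
  obtain ⟨N₀, CL, εL, hεL, hlarge⟩ := hL γ hγ T hT n hn
  -- constants at each single length (dummy values at even lengths)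
  have hS' : ∀ N : ℕ, ∃ C : ℝ, ∃ ε₀ : ℝ, 0 < ε₀ ∧ (Odd N → ∀ ε : ℝ, 0 < ε → ε < ε₀ →
      ∀ Φ : ℝ → PhaseSpace N → PhaseSpace N, IsFlow N ε γ Φ →
        ∀ a₁ a₂ : Fin N, a₁ ≤ a₂ → ∀ t : ℝ, 0 ≤ t → t ≤ ε ^ (-(n : ℝ)) →
          Integrable (fun z => (intervalEnergy N ε γ a₁ a₂ (Φ t z) - intervalEnergy N ε γ a₁ a₂ z) ^ 2)
              (gibbsMeasure N T ε γ) ∧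
            ∫ z, (intervalEnergy N ε γ a₁ a₂ (Φ t z) - intervalEnergy N ε γ a₁ a₂ z) ^ 2
                ∂(gibbsMeasure N T ε γ) ≤ C * ε ^ (1 / 4 : ℝ)) := by
    intro N
    by_cases hN : Odd N
    · obtain ⟨C, ε₀, hε₀, h⟩ := hS N hN γ hγ T hT n hn
      exact ⟨C, ε₀, hε₀, fun _ => h⟩
    · exact ⟨0, 1, one_pos, fun h => absurd h hN⟩
  choose C e he hsmall using hS'
  set s : Finset ℕ := Finset.range (N₀ + 1) with hs
  have hne : s.Nonempty := ⟨0, by simp [hs]⟩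
  refine ⟨max CL (s.sup' hne C), min εL (s.inf' hne e),
    lt_min hεL ((Finset.lt_inf'_iff hne).2 fun N _ => he N), ?_⟩
  intro ε hε hεε N hodd Φ hΦ a₁ a₂ ha t ht htε
  have hε4 : 0 ≤ ε ^ (1 / 4 : ℝ) := by positivity
  rcases le_or_gt N₀ N with hN | hN
  · obtain ⟨hi, hb⟩ := hlarge ε hε (hεε.trans_le (min_le_left _ _)) N hN hodd Φ hΦ a₁ a₂ ha t ht htε
    exact ⟨hi, hb.trans (mul_le_mul_of_nonneg_right (le_max_left _ _) hε4)⟩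
  · have hNs : N ∈ s := by
      rw [hs, Finset.mem_range]; omega
    have hεN : ε < e N := hεε.trans_le ((min_le_right _ _).trans (Finset.inf'_le e hNs))
    obtain ⟨hi, hb⟩ := hsmall N hodd ε hε hεN Φ hΦ a₁ a₂ ha t ht htε
    exact ⟨hi, hb.trans (mul_le_mul_of_nonneg_right ((Finset.le_sup' C hNs).trans (le_max_right _ _)) hε4)⟩

/-- **What remains for the catalogued fact.** `DeRoeckHuveneers2015_thm4` follows from Theorem 4
at each single odd chain length with `N`-dependent constants (the long chains being settled by
`DeRoeckHuveneers2015_thm4_largeN_holds`); equivalently, by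
`IsFlow.intervalEnergy_frozen_of_decomposition`, from the decomposition of Theorem 1 at each short
odd length — the case the source does not treat. [cite: DeRoeckHuveneers2015, §2.3 Thm 4; §5.5 Lemma 4] -/
theorem DeRoeckHuveneers2015_thm4_of_each
    (hS : ∀ N : ℕ, Odd N → ∀ γ : ℝ, 0 ≤ γ → ∀ T : ℝ, 0 < T → ∀ n : ℕ, 1 ≤ n →
      ∃ C : ℝ, ∃ ε₀ : ℝ, 0 < ε₀ ∧ ∀ ε : ℝ, 0 < ε → ε < ε₀ →
        ∀ Φ : ℝ → PhaseSpace N → PhaseSpace N, IsFlow N ε γ Φ →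
          ∀ a₁ a₂ : Fin N, a₁ ≤ a₂ → ∀ t : ℝ, 0 ≤ t → t ≤ ε ^ (-(n : ℝ)) →
            Integrable (fun z => (intervalEnergy N ε γ a₁ a₂ (Φ t z) - intervalEnergy N ε γ a₁ a₂ z) ^ 2)
                (gibbsMeasure N T ε γ) ∧
              ∫ z, (intervalEnergy N ε γ a₁ a₂ (Φ t z) - intervalEnergy N ε γ a₁ a₂ z) ^ 2
                  ∂(gibbsMeasure N T ε γ) ≤ C * ε ^ (1 / 4 : ℝ)) :
    DeRoeckHuveneers2015_thm4 :=
  DeRoeckHuveneers2015_thm4_of_largeN_of_each DeRoeckHuveneers2015_thm4_largeN_holds hS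

end Literature.Barriers.AtomisticToContinuum

end
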